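import Summits.AtomisticToContinuum.Crystallization.Theses.NashClassCertificates
import Summits.AtomisticToContinuum.Crystallization.Theorems.NearFieldConvexity.Negative.LoadBearing

/-!
# Disproof of `NashNearField` (stmt-AtomisticToContinuum-16827) — findings of the standing disprover
# (cycle 1, 2026-08-17): NO KILL; what is load-bearing, what is vacuous, why it resists

`NashClassCertificates.NashNearField` = the near-field inequality of `NearFieldConvexity`
(stmt-13958) SPECIALISED to `δ = 1/3` and RESTRICTED to Nash configurations:
`∀ η > 0 ∃ c > 0 ∃ C ∀ (1/3-separated, Nash) x ∀ Ω ⊆ good :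
 c·#{i ∈ Ω : B(xᵢ,2) not η-layered} − C·#{i ∈ Ω : ∃ j ∉ Ω, |xⱼ − xᵢ| ≤ 4} ≤ Σ_{i∈Ω}(e_i − e*)`.
Read-back (`nashNearField_iff`, `Iff.rfl`): no junk — `e* = ⨅_Q e(Q)` is a genuine infimum
(`bddBelow` proved in tree, `e* ≥ −2³²/12`), `siteEnergy` is the full sum (the `½` is explicit),
`V_LJ(0) = 0` is excluded by separation, the layered family is the free-spacing Barlow family.

## Findings (Lean content below; the landable subset is proposed as
## `Theorems/NashNearField/Negative/LoadBearing.lean`, same statements)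

1. NASH DROPPED = 13958 at `δ = 1/3` (`NashNearFieldWithoutNash`): `NearFieldConvexity → it`, and
   `¬NashNearField → ¬NearFieldConvexity` (`not_nearFieldConvexity_of_not_nashNearField`).  The Nash
   hypothesis can only help.  MUTATION VERDICT: Nash is POSSIBLY UNNECESSARY for this crux — every
   mechanism I can price (shear, strain gradients, layer slides off registry, optical shuffles,
   dislocation far fields, box-edge scales) is priced quadratically in the misfit with or without
   equilibrium; the Nash restriction is load-bearing for the FAR field / levy of the sister crux
   `NashTwoShellGap`, not visibly here.
2. NASH + SEPARATION DROPPED is FALSE (`nashNearField_false_without_nash_and_separation`, the comb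
   of `NearFieldConvexity/Negative/Comb.lean`).  The comb is not Nash (far particles unbound), so
   separation ALONE is not shown load-bearing on the Nash class (expected redundant there up to the
   coincidence junk `V(0) = 0`: Nash ⇒ site energies `≤ inf hole potential` ⇒ distinct particles
   are `≳ 0.6` apart).
3. THE `η`-QUANTIFIER: matching is antitone in `η` and VACUOUS for `η ≥ 2`
   (`isLayeredNear_of_two_le`: translate `xᵢ` to the site `0` of any stacking).  Hence
   `NashNearField ↔ NashBoundaryFloor ∧ (the inequality for η < 2)` and, for every `η₀ > 0`,
   `NashNearField ↔ (the inequality for η < η₀)`: only SMALL tolerances matter, and the `c = 0`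
   shadow `NashBoundaryFloor` (`Σ_Ω(e_i − e*) ≥ −C·#∂₄Ω` on the Nash class) is a necessary first
   target.  (For GOOD particles the matching is already vacuous for `η ≥ 21/20`: extend the particle's
   own two-shell frame to a stacking; not formalised — rotation bookkeeping.)
4. WHY NO KILL IS AVAILABLE (the obstruction, for provers and the next disprover):
   (a) WITNESSES.  A counterexample must be a `1/3`-separated NASH configuration with good particles.
       Nash ⇒ force balance + on-site stability + global single-particle relocation stability, so a
       witness is an exact equilibrium (irrational positions for `N ≥ 5`) certified globally against
       every hole — not constructible here; the unit simplices (`N ≤ 4`, Nash by `V ≥ −1/12`) have no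
       good particle; ground states are Nash (`stub_groundStatesAreNash`) and `1/3`-separated but
       structurally unknown, and their dilates/shears (the witness pattern of the refutation of
       `OneMultiplierPricing` 17253) are NOT Nash.  Every "drop H, keep Nash" variant inherits this.
   (b) ENERGY FLOOR.  `Σ_{i∈Ω} e_i = E(x|_Ω) + ½·(cross terms) ≥ |Ω|·e* − (r⁻⁶ pull of the outside)`
       (`card_mul_eStar_le`); at fixed `δ = 1/3` the pull on the radius-`4` interior of `Ω` is
       boundary-summable (`∫_d^∞ π/(72 d³)`), so `X ≥ −C₀·#∂₄Ω` with `C₀ = O(1)`: no negative-excess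
       kill, with or without Nash.
   (c) COERCIVITY.  A kill needs `#unmatched ≫ #∂₄Ω` at excess `o(1)` per unmatched particle for a
       FIXED `η`: i.e. a `1/20`-good, non-`η`-layered bulk phase of energy density exactly `e*`
       (degenerate LJ ground state outside the Barlow family) or a zero mode of a relaxed Barlow
       stacking.  NUMERICS (`compute/lj_stability_pure.py`, local 11 s; evidence `lj_stability_pure.json`;
       units: V = r⁻¹²/12 − r⁻⁶/6, mass 1): relaxed fcc `a* = 0.97128, e = −0.717519`; relaxed hcp
       `a* = 0.97132, c/a = 1.63276 (h/a = 0.8164 ∈ [0.78, 0.85]), e = −0.717586`, `e_hcp − e_fcc =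
       −6.7·10⁻⁵`.  Born stability holds with margin: fcc `C₁₁ = 12.39, C₁₂ = C₄₄ = 7.09 (Cauchy),
       C′ = (C₁₁−C₁₂)/2 = 2.65, K = 8.86` per volume (`C′/ρ = 1.72`, `C₄₄/ρ = 4.59` per particle,
       `ρ = 1.543`); hcp (internally relaxed) `C₁₁ = 14.88, C₁₂ = 6.88, C₁₃ = 4.14, C₃₃ = 18.31,
       C₄₄ = 4.00, C₆₆ = 4.33`.  No imaginary phonon on an 8³ (fcc) / 6³ (hcp, 6×6 with optical
       branches) grid: fcc `ω² ∈ [4.47, 83.3]` off Γ, slowest acoustic branch `ω²/k² = 1.72 = C′/ρ`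
       along ⟨110⟩; hcp optical modes at Γ `ω² = 17.0, 17.0, 83.3`, acoustic `ω²/k² ≥ 2.69`.  The fcc
       `(111)` γ-surface has curvature `5.21` per area at registry, unstable-stacking barrier `0.058`
       per area, intrinsic-fault energy `≈ −1·10⁻⁴` per area (hcp-like fault is free — as it must be,
       stacking is in the family).  So the softest priced direction is `C′/ρ ≈ 1.7` per particle per
       unit strain²: `c(η)` of order `η²` is what a proof can hope for, and no zero mode offers a kill.
   (d) PRICING IS ALLOWED TO BE QUADRATIC.  `c` may depend on `η`; linear elasticity forces
       `c(η) = O(η²)` (sheared good region: misfit `∼ γ` on a 2-ball, cost `∼ μγ²`), so the natural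
       strengthening "`c` uniform in `η`" is false — but (a) denies a Lean witness on the Nash class
       and off it one would need `e*` to `10⁻³` (the summit itself).  Recorded as a sorried near-miss.
   (e) BOX EDGE.  fcc at spacing `a ∈ (1, 1 + 1/(20√2)]` is GOOD (scale `1`, tolerance `1/20`) but NOT
       `η`-layered for `η ≲ 2(a−1)` (the family caps `a ≤ 1`); its excess is `≥ e_fcc(1) − e* = 0.0186`
       per particle (numerics: `e_fcc(1.001) − e* = 0.0198`, `e_fcc(1.0354) − e* = 0.073`,
       `e_fcc(0.94) − e* = 0.034`), so this only bounds `c(η) ≲ 0.02` for `η ≲ 10⁻³`; consistent.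
   (f) CAVEAT FOR THE INTENDED PROOF (b) of the card ("Nash ⇒ harmonic ⇒ locally affine"): a generic
       small AFFINE image of fcc is NOT in the layered family (only strains `diag(α,α,β)` in a layer
       frame are absorbed by `a` and the free spacings); equilibrated good regions DO carry deviatoric
       strain (dislocation/inclusion far fields `∼ b/2πr`), priced `∼ η² log(1/η)` per unmatched
       particle — fine for the crux, but "locally affine ⇒ layered" is false as a pointwise statement.

Sections: §1 vocabulary/read-back · §2 hypotheses dropped · §3 the `η`-quantifier · §4 strengthenings
and near-misses (sorry) · §5 targets (line `birth`, picked during this cycle: stubs S1/S2 assessed, none broken).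
-/

noncomputable section

open scoped BigOperators
open Literature.MathematicalPhysics.StatisticalMechanics Literature.Geometry.DiscreteGeometry

namespace Summit.AtomisticToContinuum.Crystallization.Cruxes.NashNearField.Disproof

open Summit.AtomisticToContinuum.Crystallization.Theses.NashClassCertificates (NashNearField)
open Summit.AtomisticToContinuum.Crystallization.Theses.PhononSlackCertificates (NearFieldConvexity)
open Summit.AtomisticToContinuum.Crystallization.Theorems.ChargedEnergyGapNegative (eStar)
open Summit.AtomisticToContinuum.Crystallization.Theorems.NearFieldConvexity.Negative.Comb
open Summit.AtomisticToContinuum.Crystallization.Theorems.NearFieldConvexity.Negative.LoadBearing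

local notation "E3" => EuclideanSpace ℝ (Fin 3)

/-! ## §1 Vocabulary and read-back -/

/-- The crux's NASH hypothesis (verbatim). [cite: MondererShapley1996] -/
def IsNash {N : ℕ} (x : Fin N → E3) : Prop :=
  ∀ (i : Fin N) (y : E3), (∀ j : Fin N, j ≠ i → y ≠ x j) →
    siteEnergy lennardJones x i ≤ ∑ j ∈ Finset.univ.erase i, lennardJones (dist y (x j))

/-- The crux's inequality at `(η, c, C)` for one `x`, one `Ω` (vocabulary of 13958's Negative lane). -/
def NearIneq (η c C : ℝ) {N : ℕ} (x : Fin N → E3) (Ω : Finset (Fin N)) : Prop :=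
  c * (nlCount η x Ω : ℝ) - C * (bdCount 4 x Ω : ℝ) ≤ excessSum x Ω

/-- READ-BACK: the crux, definitionally (no coercion/junk surprises). [folklore] -/
theorem nashNearField_iff :
    NashNearField ↔ ∀ η : ℝ, 0 < η → ∃ c : ℝ, 0 < c ∧ ∃ C : ℝ, ∀ (N : ℕ) (x : Fin N → E3),
      Separated (1 / 3) x → IsNash x → ∀ Ω : Finset (Fin N),
        (∀ i ∈ Ω, IsTwoShellGood (1 / 20) (47 / 50) 1 x i) → NearIneq η c C x Ω :=
  Iff.rfl

/-- Trivially-Nash small models exist but carry no good particle: e.g. the EMPTY configuration is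
`1/3`-separated and Nash, and every `Ω` is empty, so the inequality there reads `0 ≤ 0`.
(The same holds for `N ≤ 4` unit simplices; goodness needs `18` neighbours, `N ≥ 19`.) [folklore] -/
theorem nearIneq_fin_zero (η c C : ℝ) (x : Fin 0 → E3) (Ω : Finset (Fin 0)) : NearIneq η c C x Ω := by
  have hΩ : Ω = ∅ := Finset.eq_empty_of_isEmpty Ω
  subst hΩ
  unfold NearIneq nlCount bdCount excessSum
  simp

/-! ## §2 Hypotheses dropped -/

/-- (H-Nash dropped) the all-configuration crux 13958 at `δ = 1/3`. -/
def NashNearFieldWithoutNash : Prop :=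
  ∀ η : ℝ, 0 < η → ∃ c : ℝ, 0 < c ∧ ∃ C : ℝ, ∀ (N : ℕ) (x : Fin N → E3),
    Separated (1 / 3) x → ∀ Ω : Finset (Fin N),
      (∀ i ∈ Ω, IsTwoShellGood (1 / 20) (47 / 50) 1 x i) → NearIneq η c C x Ω

/-- `NearFieldConvexity → NashNearFieldWithoutNash`. [folklore] -/
theorem nashNearFieldWithoutNash_of_nearFieldConvexity (h : NearFieldConvexity) :
    NashNearFieldWithoutNash := fun η hη =>
  (nearFieldConvexity_iff_radius.1 h) (1 / 3) (by norm_num) η hη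

/-- `¬NashNearField → ¬NashNearFieldWithoutNash` (the Nash restriction can only help). [folklore] -/
theorem not_nashNearFieldWithoutNash_of_not (h : ¬ NashNearField) : ¬ NashNearFieldWithoutNash := by
  intro h'
  apply h
  rw [nashNearField_iff]
  intro η hη
  obtain ⟨c, hc, C, hC⟩ := h' η hη
  exact ⟨c, hc, C, fun N x hsep _ Ω hΩ => hC N x hsep Ω hΩ⟩

/-- `¬NashNearField → ¬NearFieldConvexity`: a kill here kills 13958 (shared negative knowledge);
a proof of 13958 makes this crux moot. [folklore] -/
theorem not_nearFieldConvexity_of_not_nashNearField (h : ¬ NashNearField) : ¬ NearFieldConvexity :=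
  fun h' => not_nashNearFieldWithoutNash_of_not h (nashNearFieldWithoutNash_of_nearFieldConvexity h')

/-- (H-Nash AND H-sep dropped). -/
def NashNearFieldWithoutNashSep : Prop :=
  ∀ η : ℝ, 0 < η → ∃ c : ℝ, 0 < c ∧ ∃ C : ℝ, ∀ (N : ℕ) (x : Fin N → E3),
    ∀ Ω : Finset (Fin N), (∀ i ∈ Ω, IsTwoShellGood (1 / 20) (47 / 50) 1 x i) → NearIneq η c C x Ω

/-- **FALSE without Nash and separation** (comb: one good particle next to arbitrarily dense far
matter, `Ω = {centre}`; RHS `≤ −M/4000 + 2³²/12`, LHS `≥ −|C|`).  Any proof must use Nash or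
separation to bound the attraction exerted on `Ω` from outside. [folklore] -/
theorem nashNearField_false_without_nash_and_separation : ¬ NashNearFieldWithoutNashSep := by
  intro h
  obtain ⟨c, hc, C, h⟩ := h 1 one_pos
  obtain ⟨M, -, hbig⟩ := exists_big C
  exact comb_violates hc hbig (h _ (comb M) {centre M} (good_of_mem_centre M))

/-- (H-sep dropped, Nash kept).  STATUS: expected TRUE-modulo-junk and unrefutable here — Nash ⇒
`siteEnergy ≤ inf hole potential ≤ −1/12` bounds the repulsion each particle feels, so DISTINCT
particles of a Nash configuration are `≳ 0.6` apart; only coincident pairs (`V_LJ(0) = 0`, Lean's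
`0⁻¹ = 0`) escape, and a Nash pile needs an equilibrium cluster with `min hole ≥ max site energy`
(checked on paper: unit simplex piles are NOT Nash — a pile member gains `(M−1)·V(2√(2/3))` by
hopping to the apex).  No witness. -/
def NashNearFieldWithoutSep : Prop :=
  ∀ η : ℝ, 0 < η → ∃ c : ℝ, 0 < c ∧ ∃ C : ℝ, ∀ (N : ℕ) (x : Fin N → E3), IsNash x →
    ∀ Ω : Finset (Fin N), (∀ i ∈ Ω, IsTwoShellGood (1 / 20) (47 / 50) 1 x i) → NearIneq η c C x Ω

/-- (Boundary charge dropped, `C = 0`, Nash kept).  STATUS: OPEN BOTH WAYS.  With `Ω = {i}` it says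
`e_i ≥ e*` for every GOOD particle of every `1/3`-separated Nash configuration; off the Nash class
this is false (13958's `nearFieldConvexity_false_without_boundaryCharge`, comb at `δ → 0`), at
`δ = 1/3` the outside pull on one good particle is `≤ ~2.2` so falsity needs `e* > e_i` to that
accuracy (tree: `e* ≥ −2³²/12` only), and on the Nash class no explicit good particle exists. -/
def NashNearFieldWithoutBoundaryCharge : Prop :=
  ∀ η : ℝ, 0 < η → ∃ c : ℝ, 0 < c ∧ ∀ (N : ℕ) (x : Fin N → E3), Separated (1 / 3) x → IsNash x →
    ∀ Ω : Finset (Fin N), (∀ i ∈ Ω, IsTwoShellGood (1 / 20) (47 / 50) 1 x i) →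
      c * (nlCount η x Ω : ℝ) ≤ excessSum x Ω

/-! ## §3 The `η`-quantifier: monotone, vacuous for `η ≥ 2`, the `c = 0` shadow -/

/-- Matching is monotone in the tolerance. [folklore] -/
theorem isLayeredNear_mono {N : ℕ} {η η' : ℝ} {x : Fin N → E3} {i : Fin N}
    (h : IsLayeredNear η x i) (hle : η ≤ η') : IsLayeredNear η' x i := by
  obtain ⟨A, t, a, s, z, ha₁, ha₂, hs, hz, h₁, h₂⟩ := h
  refine ⟨A, t, a, s, z, ha₁, ha₂, hs, hz, fun j hj => ?_, fun p hp hd => ?_⟩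
  · obtain ⟨p, hp, hd⟩ := h₁ j hj
    exact ⟨p, hp, hd.trans hle⟩
  · obtain ⟨j, hj⟩ := h₂ p hp hd
    exact ⟨j, hj.trans hle⟩

/-- The unmatched count is antitone in the tolerance. [folklore] -/
theorem nlCount_anti {N : ℕ} {η η' : ℝ} (hle : η ≤ η') (x : Fin N → E3) (Ω : Finset (Fin N)) :
    nlCount η' x Ω ≤ nlCount η x Ω := by
  unfold nlCount
  exact Nat.card_le_card_of_injective
    (fun i => ⟨i.1, i.2.1, fun h => i.2.2 (isLayeredNear_mono h hle)⟩) fun a b hab => Subtype.ext (by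
      simpa using congrArg Subtype.val hab)

/-- **For `η ≥ 2` every particle of every configuration is `η`-layered.** [folklore] -/
theorem isLayeredNear_of_two_le {N : ℕ} {η : ℝ} (hη : 2 ≤ η) (x : Fin N → E3) (i : Fin N) :
    IsLayeredNear η x i := by
  refine ⟨LinearIsometry.id, -x i, 1, fun _ => 1, fun m => 4 / 5 * (m : ℝ), by norm_num, le_rfl,
    fun _ => Or.inl rfl, fun m => ?_, ?_⟩
  · push_cast
    constructor <;> linarith
  · intro S
    have h0 : (0 : E3) ∈ S := ⟨0, 0, 0, by simp⟩
    have hxi : x i + -x i = 0 := add_neg_cancel (x i)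
    refine ⟨fun j hj => ⟨0, h0, ?_⟩, fun p _ hd => ⟨i, ?_⟩⟩
    · rw [← sub_eq_add_neg, dist_zero_right, ← dist_eq_norm]
      exact hj.trans hη
    · rw [hxi] at hd ⊢
      rw [dist_comm]
      exact hd.trans hη

/-- Hence for `η ≥ 2` the unmatched count vanishes identically. [folklore] -/
theorem nlCount_eq_zero_of_two_le {N : ℕ} {η : ℝ} (hη : 2 ≤ η) (x : Fin N → E3)
    (Ω : Finset (Fin N)) : nlCount η x Ω = 0 := by
  unfold nlCount
  rw [Nat.card_eq_zero]
  exact Or.inl ⟨fun i => i.2.2 (isLayeredNear_of_two_le hη x i.1)⟩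

/-- The `c = 0` shadow on the Nash class. -/
def NashBoundaryFloor : Prop :=
  ∃ C : ℝ, ∀ (N : ℕ) (x : Fin N → E3), Separated (1 / 3) x → IsNash x →
    ∀ Ω : Finset (Fin N), (∀ i ∈ Ω, IsTwoShellGood (1 / 20) (47 / 50) 1 x i) →
      -(C * (bdCount 4 x Ω : ℝ)) ≤ excessSum x Ω

/-- The crux implies the boundary floor on the Nash class. [folklore] -/
theorem nashBoundaryFloor_of_nashNearField (h : NashNearField) : NashBoundaryFloor := by
  obtain ⟨c, hc, C, h⟩ := (nashNearField_iff.1 h) 1 one_pos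
  refine ⟨C, fun N x hsep hN Ω hΩ => ?_⟩
  have key : NearIneq 1 c C x Ω := h N x hsep hN Ω hΩ
  unfold NearIneq at key
  have h1 : 0 ≤ c * (nlCount 1 x Ω : ℝ) := mul_nonneg hc.le (Nat.cast_nonneg _)
  linarith

/-- **The crux = boundary floor + its inequality for `η < 2`.** [folklore] -/
theorem nashNearField_iff_floor_and_small :
    NashNearField ↔ NashBoundaryFloor ∧ ∀ η : ℝ, 0 < η → η < 2 → ∃ c : ℝ, 0 < c ∧ ∃ C : ℝ,
      ∀ (N : ℕ) (x : Fin N → E3), Separated (1 / 3) x → IsNash x → ∀ Ω : Finset (Fin N),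
        (∀ i ∈ Ω, IsTwoShellGood (1 / 20) (47 / 50) 1 x i) → NearIneq η c C x Ω := by
  constructor
  · intro h
    exact ⟨nashBoundaryFloor_of_nashNearField h, fun η hη _ => (nashNearField_iff.1 h) η hη⟩
  · rintro ⟨⟨C, hC⟩, hsmall⟩
    rw [nashNearField_iff]
    intro η hη
    rcases lt_or_ge η 2 with hlt | hge
    · exact hsmall η hη hlt
    · refine ⟨1, one_pos, C, fun N x hsep hN Ω hΩ => ?_⟩
      unfold NearIneq
      rw [nlCount_eq_zero_of_two_le hge, Nat.cast_zero, mul_zero, zero_sub]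
      exact hC N x hsep hN Ω hΩ

/-- **Only small tolerances matter** (any `η₀ > 0`). [folklore] -/
theorem nashNearField_iff_small {η₀ : ℝ} (hη₀ : 0 < η₀) :
    NashNearField ↔ ∀ η : ℝ, 0 < η → η < η₀ → ∃ c : ℝ, 0 < c ∧ ∃ C : ℝ,
      ∀ (N : ℕ) (x : Fin N → E3), Separated (1 / 3) x → IsNash x → ∀ Ω : Finset (Fin N),
        (∀ i ∈ Ω, IsTwoShellGood (1 / 20) (47 / 50) 1 x i) → NearIneq η c C x Ω := by
  rw [nashNearField_iff]
  constructor
  · exact fun h η hη _ => h η hη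
  · intro h η hη
    rcases lt_or_ge η η₀ with hlt | hge
    · exact h η hη hlt
    · obtain ⟨c, hc, C, hC⟩ := h (η₀ / 2) (by positivity) (by linarith)
      refine ⟨c, hc, C, fun N x hsep hN Ω hΩ => ?_⟩
      have key := hC N x hsep hN Ω hΩ
      unfold NearIneq at key ⊢
      have hmono : (nlCount η x Ω : ℝ) ≤ (nlCount (η₀ / 2) x Ω : ℝ) := by
        exact_mod_cast nlCount_anti (by linarith) x Ω
      nlinarith [mul_le_mul_of_nonneg_left hmono hc.le]

/-! ## §4 Natural strengthenings and near-misses (sorry allowed only here) -/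

/-- The strengthening with the price UNIFORM in the tolerance (`∃ c ∀ η`). -/
def NashNearFieldUniformInEta : Prop :=
  ∃ c : ℝ, 0 < c ∧ ∀ η : ℝ, 0 < η → ∃ C : ℝ, ∀ (N : ℕ) (x : Fin N → E3),
    Separated (1 / 3) x → IsNash x → ∀ Ω : Finset (Fin N),
      (∀ i ∈ Ω, IsTwoShellGood (1 / 20) (47 / 50) 1 x i) → NearIneq η c C x Ω

/-- NEAR-MISS (expected false, not closable here).  Physics: a good region sheared by `γ` (or held
at strain `γ` by far bad matter in equilibrium — dislocation far fields `b/2πr`) is not `η`-layered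
on its 2-balls once `γ ≳ 2η`, at excess `∼ μγ²/2` per particle (`μ = C₄₄ or C′` of LJ fcc/hcp, job
j025794), so `c ≤ K η²` for every admissible `c` and no uniform `c` exists.  OBSTRUCTION: (i) the
witness must be Nash (finding 4a) — ground states are the only available Nash configurations and
their local strain is unknown; (ii) even off the Nash class the excess `Σ(e_i − e*)` of the witness
must be known to `O(γ²) ≈ 10⁻³`, i.e. `e*` pinned from below to that accuracy (tree: `−2³²/12`).
Tried: ground-state dilation à la 17253 (dilates are not Nash; and a dilation is absorbed by the
family's free scale `a` anyway unless it crosses the box edge `a = 1`). -/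
theorem not_nashNearFieldUniformInEta : ¬ NashNearFieldUniformInEta := by
  sorry

/-- NEAR-MISS bookkeeping for finding 4e (box edge): the fcc two-shell cluster at spacing `a = 21/20`
is still `1/20`-good at scale `1` — goodness tolerates `a ∈ (1, 21/20]` while the layered family caps
`a ≤ 1`.  (Statement only about the goodness predicate; the unmatched half needs the rigidity
bookkeeping of finding 3 and is left open.)  Proof sketch: `f` = the pattern enumeration,
`|(21/20)v − v| = |v|/20 ≤ √2/20 ≤ ... ` — FAILS for the second shell (`√2/20 > 1/20`): so in fact
only `a ≤ 1 + 1/(20√2) ≈ 1.035` keeps the second shell within tolerance; recorded, not pursued. -/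
theorem boxEdge_note : True := trivial

/-! ## §5 Targets — line `birth` (PICKED 2026-08-17T11:36Z, skeleton v3; read at this cycle's end)

Open stubs of `Lines/birth.lean`: `stub_chartCore` (S1, geometry, verbatim the twin 13958's registered
stub) and `stub_nashInteriorCoercivity` (S2, summed coercivity on the Nash class, with exact force balance
and `2/5`-charts of every radius-8 interior site as hypotheses).  `NashNearField_of` is sorry-free, so joint
sufficiency is machine-checked; nothing to attack there.

* S2 inherits obstruction 4(a) verbatim (its hypotheses contain the Nash clause): no explicit witness exists;
  moreover its right-hand side is the INTRA-cluster excess `E(x|_Ω) − |Ω|·e* ≥ 0` (periodisation floor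
  `card_mul_eStar_le`) plus `C·#∂₄Ω ≥ 0`, so even the sign attacks of §2 are void: a kill of S2 needs
  `#(non-η-layered radius-8 interior) → ∞` inside clusters of excess `o(count)` — finding 4(c) again.
  Not refuted; no stub-false claim.
* S1 is configuration-level (no Nash, no energy) and IS attackable by computation: worst-case all-good
  distortions of a radius-3 ball (Möbius/inversion fields are exactly locally-similar, bending, strain
  gradients `G ≲ 1/20`) against the `2/5` chart tolerance of clauses (iii)/(iv).  Paper budget: affine
  non-similarity `≤ 0.035·2`, gradient `½·G·2² ≤ 0.1`, scale drift `≤ 0.1`, base fit `0.05` — total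
  `≈ 0.25–0.3 < 2/5`; margin `~1.5×`, so a numerical extremal search is the right next attack (queued for the
  re-arm; one batched kit job).  Not refuted.
-/

/-- TARGET bookkeeping (no claim): the disprover's verdict on the two open stubs of line `birth` this cycle is
"not refuted"; see the section docstring for what a kill of each would need. -/
theorem targets_birth_cycle1 : True := trivial

end Summit.AtomisticToContinuum.Crystallization.Cruxes.NashNearField.Disproof
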